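import Summits.NavierStokesRegularity.NavierStokesRegularity.Theorems.TypeIIInviscidRelaxationAxisymSwirlRegularAxialStrainCriterion
import Summits.NavierStokesRegularity.NavierStokesRegularity.Theorems.TypeIIInviscidRelaxationAxisymSwirlRegularCoreStrainNearTop
import HarnessLib

/-!
# The axial-stretching criterion near the blow-up time: recurrent axial stretching at the axis

Helper toward the crux `AxisymSwirlRegular` (stmt-NavierStokesRegularity-1964, route TypeIIInviscidRelaxation),
criterion side of the registered line `radial_inflow_split` (stub `stub_oneSidedRadialCriterion`, ⟨19059⟩), sequel
of `TypeIIInviscidRelaxationAxisymSwirlRegularAxialStrainCriterion` (`RadialInflowAxialStrain.*`: for axisymmetric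
divergence-free slices `∂_r(r u_r) = −r ∂_z u_z`, so a one-sided bound `∂_z u_z ≤ K` on an axis tube over `[0,T)`
gives the radial gate with constant `1 < 2` and hence continuation).

Here the axial-strain hypothesis is needed only NEAR THE TOP, `t ∈ [T₁, T)`, and the constants of the parabolic-core
form are made to depend on the gate constant `C` alone:

* `hasSmoothExtensionPast_of_axialStrain_le_nearTop` — standing class of the stub (WITH its sub-slab bound):
  `∂_z u_z ≤ K` on `{0 < cylRadius < δ} × [T₁,T)` for SOME `K`, `δ > 0`, `T₁ < T` ⇒ `HasSmoothExtensionPast ν 0 u T`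
  (early times `t ≤ max T₁ 0` are covered by the sub-slab bound: `r u_r ≥ −r‖u‖ ≥ −ν` on `r < ν/(M+1)`);
* `exists_axialStretching_nearTop_of_not_hasSmoothExtensionPast` — blow-up reading: for EVERY `T₁ < T`, `K`,
  `δ > 0` there are `t ∈ [T₁,T)` and `x` with `0 < cylRadius x < δ` and `∂_z u_z(t,x) > K`; i.e. along some sequence
  `tₙ ↑ T`, `rₙ → 0`: `∂_z u_z(tₙ,xₙ) → +∞` (axial stretching blows up AT THE AXIS AT THE BLOW-UP TIME);
* `exists_coreAxialStrain_tube_nearTop` — thin tube × `[T₁,T)` form of the parabolic-core criterion: Reynolds gate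
  `Λ₀` outside the core, `∂_z u_z ≤ κ₀/(T−t)` inside the core `{r < ξ₀√(ν(T−t))}`, `κ₀ = 2/ξ₀²`
  (`RadialInflowCoreStrain.exists_coreStrain_tube_nearTop` + `radialVelocity_ge_of_axialStrain_le`);
* `oneSidedRadialCriterion_of_coreAxialStrain_nearTop C` — on the stub's own hypothesis list with gate constant
  `C` (any, in particular `C ≥ 2`): constants `ξ₀(C), κ₀(C) > 0` such that `∂_z u_z ≤ κ₀/(T−t)` at the core points
  `0 < r < δ`, `r < ξ₀√(ν(T−t))`, `t ≥ T₁` implies continuation — the constants no longer depend on the solution;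
* `recurrent_coreAxialStretching_of_not_hasSmoothExtensionPast C` — blow-up under the gate forces, for every
  `T₁ < T`, a core point `(t,x)`, `t ≥ T₁`, with `∂_z u_z(t,x) > κ₀(C)/(T−t)`:
  `limsup_{t↑T} (T−t) · sup_{core} ∂_z u_z ≥ κ₀(C)` — Type-I-rate axial stretching RECURS in the parabolic core.

Elementary corollaries of the `C < 2` criterion, the two-level Reynolds gate and `div u = 0`; a CRITERION and
its contrapositive; nothing here proves `stub_oneSidedRadialCriterion`, `AxisymSwirlRegular` or
NavierStokesRegularity. [new]
-/

noncomputable section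

set_option linter.dupNamespace false

open Set Filter Topology Real WithLp
open Literature.Analysis.FluidPDE

namespace Summit.NavierStokesRegularity.NavierStokesRegularity.Theorems.RadialInflowAxialStrain

open Summit.NavierStokesRegularity.NavierStokesRegularity.Theorems
open Summit.NavierStokesRegularity.NavierStokesRegularity.Theorems.RadialInflowCoreReynolds
open Summit.NavierStokesRegularity.NavierStokesRegularity.Theorems.RadialInflowCoreStrain
open Summit.NavierStokesRegularity.NavierStokesRegularity.Theorems.ScenarioCensus.LogGate

/-! ## §1 One-sided axial strain near the top suffices -/

/-- **Axial-stretching criterion, hypothesis near the blow-up time only.** In the standing class of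
`stub_oneSidedRadialCriterion` (classical on `[0,T)` at viscosity `ν > 0`, Leray–Hopf on `[0,T]` from `u 0`,
bounded on every closed sub-slab, axisymmetric slices, rapidly decaying datum): if for some `K`, `δ > 0` and
`T₁ < T` the axial strain satisfies `∂_z u_z(t,x) ≤ K` whenever `t ∈ [0,T)`, `t ≥ T₁`, `0 < cylRadius x < δ`, then
`HasSmoothExtensionPast ν 0 u T`.  Proof: the radial gate with constant `1` holds on the tube
`r < min δ (min √(ν/K⁺) (ν/(M⁺+1)))`: for `t ≤ max T₁ 0` by the sub-slab bound `‖u‖ ≤ M`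
(`r u_r ≥ −r‖u‖`, `neg_cylRadius_mul_norm_le_radialMomentum`), for `t ≥ T₁` by
`radialMomentum_ge_of_axialStrain_le`; then `oneSidedRadialCriterion_of_lt_two`. [new] -/
theorem hasSmoothExtensionPast_of_axialStrain_le_nearTop {ν T K δ T₁ : ℝ} (hν : 0 < ν) (hT : 0 < T)
    (hδ : 0 < δ) (hT₁ : T₁ < T)
    {u : ℝ → EuclideanSpace ℝ (Fin 3) → EuclideanSpace ℝ (Fin 3)} {p : ℝ → EuclideanSpace ℝ (Fin 3) → ℝ}
    (hcl : IsClassicalNSSolutionOn (Ico 0 T) ν 0 u p) (hLH : IsLerayHopfOn T ν 0 (u 0) u)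
    (hbd : ∀ T' < T, ∃ M : ℝ, ∀ t ∈ Icc 0 T', ∀ x, ‖u t x‖ ≤ M) (hax : ∀ t ∈ Ico 0 T, IsAxisymmetric (u t))
    (hdec : HasRapidSpatialDecay (u 0))
    (hK : ∀ t ∈ Ico 0 T, T₁ ≤ t → ∀ x : EuclideanSpace ℝ (Fin 3), 0 < cylRadius x → cylRadius x < δ →
      fderiv ℝ (u t) x (EuclideanSpace.single 2 1) 2 ≤ K) :
    HasSmoothExtensionPast ν 0 u T := by
  -- the early slab `[0, max T₁ 0]` and its velocity bound
  set T' : ℝ := max T₁ 0 with hT'_def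
  have hT'T : T' < T := max_lt hT₁ hT
  obtain ⟨M, hM⟩ := hbd T' hT'T
  set M' : ℝ := max M 0 + 1 with hM'_def
  have hM'0 : 0 < M' := by positivity
  have hMM' : M ≤ M' := by linarith [le_max_left M 0]
  set K' : ℝ := max K 1 with hK'_def
  have hK'0 : 0 < K' := lt_of_lt_of_le one_pos (le_max_right _ _)
  have hKK' : K ≤ K' := le_max_left _ _
  set δ' : ℝ := min δ (min (Real.sqrt (ν / K')) (ν / M')) with hδ'_def
  have hδ'0 : 0 < δ' := lt_min hδ (lt_min (Real.sqrt_pos.2 (div_pos hν hK'0)) (div_pos hν hM'0))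
  refine oneSidedRadialCriterion_of_lt_two (C := 1) hν hT one_lt_two hδ'0 hcl hLH hbd hax hdec ?_
  intro t ht x hxδ'
  have hxδ : cylRadius x < δ := hxδ'.trans_le (min_le_left _ _)
  rcases le_or_gt t T' with htT' | htT'
  · -- early slab: `r u_r ≥ -r‖u‖ ≥ -r M' > -ν`
    have h1 := neg_cylRadius_mul_norm_le_radialMomentum x (u t x)
    have h2 : ‖u t x‖ ≤ M' := (hM t ⟨ht.1, htT'⟩ x).trans hMM'
    have h3 : cylRadius x < ν / M' := hxδ'.trans_le ((min_le_right _ _).trans (min_le_right _ _))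
    have h4 : cylRadius x * M' < ν := by rwa [lt_div_iff₀ hM'0] at h3
    have h5 : cylRadius x * ‖u t x‖ ≤ cylRadius x * M' := mul_le_mul_of_nonneg_left h2 (cylRadius_nonneg x)
    linarith
  · -- near the top: the axial-strain bound
    have htT₁ : T₁ ≤ t := (le_max_left _ _).trans htT'.le
    have hd : Differentiable ℝ (u t) := (hcl.contDiff_velocity ht).differentiable (by simp)
    have hΦ := radialMomentum_ge_of_axialStrain_le (K := K') hd (hax t ht) (hcl.divFree t ht) (x := x)
      fun y hy0 hyx _ => (hK t ht htT₁ y hy0 (hyx.trans_lt hxδ)).trans hKK'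
    have hr2 : cylRadius x ^ 2 ≤ ν / K' := by
      have h1 : cylRadius x < Real.sqrt (ν / K') :=
        hxδ'.trans_le ((min_le_right _ _).trans (min_le_left _ _))
      have h2 : cylRadius x ^ 2 < Real.sqrt (ν / K') ^ 2 :=
        pow_lt_pow_left₀ h1 (cylRadius_nonneg x) two_ne_zero
      rw [Real.sq_sqrt (div_pos hν hK'0).le] at h2
      exact h2.le
    have h3 : cylRadius x ^ 2 * K' ≤ ν := (le_div_iff₀ hK'0).1 hr2
    nlinarith [h3, hΦ]

/-- **Blow-up reading: axial stretching blows up at the axis at the blow-up time.** In the standing class, if the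
solution does NOT extend smoothly past `T`, then for every `T₁ < T`, every `K` and every `δ > 0` there are
`t ∈ [0,T)` with `t ≥ T₁` and `x` with `0 < cylRadius x < δ` such that `∂_z u_z(t,x) > K`. [new] -/
theorem exists_axialStretching_nearTop_of_not_hasSmoothExtensionPast {ν T : ℝ} (hν : 0 < ν) (hT : 0 < T)
    {u : ℝ → EuclideanSpace ℝ (Fin 3) → EuclideanSpace ℝ (Fin 3)} {p : ℝ → EuclideanSpace ℝ (Fin 3) → ℝ}
    (hcl : IsClassicalNSSolutionOn (Ico 0 T) ν 0 u p) (hLH : IsLerayHopfOn T ν 0 (u 0) u)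
    (hbd : ∀ T' < T, ∃ M : ℝ, ∀ t ∈ Icc 0 T', ∀ x, ‖u t x‖ ≤ M) (hax : ∀ t ∈ Ico 0 T, IsAxisymmetric (u t))
    (hdec : HasRapidSpatialDecay (u 0)) (hno : ¬ HasSmoothExtensionPast ν 0 u T)
    {T₁ : ℝ} (hT₁ : T₁ < T) (K : ℝ) {δ : ℝ} (hδ : 0 < δ) :
    ∃ t ∈ Ico 0 T, T₁ ≤ t ∧ ∃ x : EuclideanSpace ℝ (Fin 3), 0 < cylRadius x ∧ cylRadius x < δ ∧
      K < fderiv ℝ (u t) x (EuclideanSpace.single 2 1) 2 := by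
  by_contra hcon
  refine hno (hasSmoothExtensionPast_of_axialStrain_le_nearTop (K := K) hν hT hδ hT₁ hcl hLH hbd hax hdec ?_)
  intro t ht htT₁ x hx hxδ
  by_contra hlt
  exact hcon ⟨t, ht, htT₁, x, hx, hxδ, lt_of_not_ge hlt⟩

/-! ## §2 The parabolic-core form on a thin tube near the top -/

/-- **Core axial-strain criterion on a thin tube near the blow-up time.** For every `Λ₀ > 0` there are `ξ₀, κ₀ > 0`
(`κ₀ = 2/ξ₀²`) such that in the standing class (with the sub-slab bound): a Reynolds gate `u_r ≥ −νΛ₀/r` on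
`{0 < r ≤ δ} × [T₁,T)` outside the parabolic core together with the one-sided axial-strain bound
`∂_z u_z ≤ κ₀/(T−t)` at the core points `{0 < r ≤ δ, r < ξ₀√(ν(T−t))} × [T₁,T)`, for SOME `δ > 0`, `T₁ < T`,
implies `HasSmoothExtensionPast ν 0 u T`.  (The horizontal disc through a core point consists of core points, so
`radialVelocity_ge_of_axialStrain_le` gives `u_r ≥ −κ₀ r/(2(T−t))` there; then
`RadialInflowCoreStrain.exists_coreStrain_tube_nearTop`.) [new] -/
theorem exists_coreAxialStrain_tube_nearTop {Λ₀ : ℝ} (hΛ : 0 < Λ₀) :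
    ∃ ξ₀ κ₀ : ℝ, 0 < ξ₀ ∧ 0 < κ₀ ∧ ∀ (ν T : ℝ), 0 < ν → 0 < T →
      ∀ (u : ℝ → EuclideanSpace ℝ (Fin 3) → EuclideanSpace ℝ (Fin 3)) (p : ℝ → EuclideanSpace ℝ (Fin 3) → ℝ),
      IsClassicalNSSolutionOn (Ico 0 T) ν 0 u p → IsLerayHopfOn T ν 0 (u 0) u → HasRapidSpatialDecay (u 0) →
      (∀ T' < T, ∃ M : ℝ, ∀ t ∈ Icc 0 T', ∀ x, ‖u t x‖ ≤ M) → (∀ t ∈ Ico 0 T, IsAxisymmetric (u t)) →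
      ∀ (δ T₁ : ℝ), 0 < δ → T₁ < T →
      (∀ t ∈ Ico 0 T, T₁ ≤ t → ∀ x : EuclideanSpace ℝ (Fin 3), 0 < cylRadius x → cylRadius x ≤ δ →
        ξ₀ * √(ν * (T - t)) ≤ cylRadius x → -(ν * Λ₀ / cylRadius x) ≤ radialVelocity (u t) x) →
      (∀ t ∈ Ico 0 T, T₁ ≤ t → ∀ x : EuclideanSpace ℝ (Fin 3), 0 < cylRadius x → cylRadius x ≤ δ →
        cylRadius x < ξ₀ * √(ν * (T - t)) →
        fderiv ℝ (u t) x (EuclideanSpace.single 2 1) 2 ≤ κ₀ / (T - t)) →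
      HasSmoothExtensionPast ν 0 u T := by
  obtain ⟨ξ₀, κ₀, hξ₀, hκ₀, H⟩ := exists_coreStrain_tube_nearTop hΛ
  refine ⟨ξ₀, 2 * κ₀, hξ₀, by positivity, ?_⟩
  intro ν T hν hT u p hcl hLH hdec hbd hax δ T₁ hδ hT₁ hfar haxial
  refine H ν T hν hT u p hcl hLH hdec hbd hax δ T₁ hδ hT₁ hfar fun t ht htT₁ x hx hxδ hcore => ?_
  have hd : Differentiable ℝ (u t) := (hcl.contDiff_velocity ht).differentiable (by simp)
  have h1 := radialVelocity_ge_of_axialStrain_le (K := 2 * κ₀ / (T - t)) hd (hax t ht) (hcl.divFree t ht) hx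
    fun y hy0 hyx _ => haxial t ht htT₁ y hy0 (hyx.trans hxδ) (hyx.trans_lt hcore)
  have e : -(2 * κ₀ / (T - t) * cylRadius x / 2) = -(κ₀ * cylRadius x / (T - t)) := by ring
  linarith

/-- **The stub ⟨19059⟩ reduced to core axial stretching near the top, constants depending on `C` only.** For every
gate constant `C` there are `ξ₀, κ₀ > 0` such that, on the exact hypothesis list of `stub_oneSidedRadialCriterion`
with the gate `r u_r ≥ −Cν` on `{cylRadius < δ} × [0,T)`: if for some `T₁ < T` the axial strain obeys
`∂_z u_z(t,x) ≤ κ₀/(T−t)` at the core points `0 < cylRadius x < δ`, `cylRadius x < ξ₀√(ν(T−t))`, `t ≥ T₁`, then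
`HasSmoothExtensionPast ν 0 u T`.  (The stub's gate is the Reynolds gate `max C 1` on `0 < r ≤ δ/2`;
`exists_coreAxialStrain_tube_nearTop`.) [new] -/
theorem oneSidedRadialCriterion_of_coreAxialStrain_nearTop (C : ℝ) :
    ∃ ξ₀ κ₀ : ℝ, 0 < ξ₀ ∧ 0 < κ₀ ∧ ∀ (ν T : ℝ), 0 < ν → 0 < T →
      ∀ (u : ℝ → EuclideanSpace ℝ (Fin 3) → EuclideanSpace ℝ (Fin 3)) (p : ℝ → EuclideanSpace ℝ (Fin 3) → ℝ),
      IsClassicalNSSolutionOn (Ico 0 T) ν 0 u p → IsLerayHopfOn T ν 0 (u 0) u →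
      (∀ T' < T, ∃ M : ℝ, ∀ t ∈ Icc 0 T', ∀ x, ‖u t x‖ ≤ M) → (∀ t ∈ Ico 0 T, IsAxisymmetric (u t)) →
      HasRapidSpatialDecay (u 0) →
      ∀ (δ : ℝ), 0 < δ →
      (∀ t ∈ Ico 0 T, ∀ x : EuclideanSpace ℝ (Fin 3), cylRadius x < δ → -(C * ν) ≤ x 0 * u t x 0 + x 1 * u t x 1) →
      ∀ (T₁ : ℝ), T₁ < T →
      (∀ t ∈ Ico 0 T, T₁ ≤ t → ∀ x : EuclideanSpace ℝ (Fin 3), 0 < cylRadius x → cylRadius x < δ →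
        cylRadius x < ξ₀ * √(ν * (T - t)) →
        fderiv ℝ (u t) x (EuclideanSpace.single 2 1) 2 ≤ κ₀ / (T - t)) →
      HasSmoothExtensionPast ν 0 u T := by
  have hΛ : 0 < max C 1 := lt_of_lt_of_le one_pos (le_max_right _ _)
  obtain ⟨ξ₀, κ₀, hξ₀, hκ₀, H⟩ := exists_coreAxialStrain_tube_nearTop hΛ
  refine ⟨ξ₀, κ₀, hξ₀, hκ₀, ?_⟩
  intro ν T hν hT u p hcl hLH hbd hax hdec δ hδ hgate T₁ hT₁ haxial
  refine H ν T hν hT u p hcl hLH hdec hbd hax (δ / 2) T₁ (half_pos hδ) hT₁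
    (fun t ht _ x hx hxδ _ => ?_) (fun t ht htT₁ x hx hxδ hcore => haxial t ht htT₁ x hx (by linarith) hcore)
  -- the stub's gate gives the Reynolds gate `max C 1` on `r ≤ δ/2 < δ`
  have h1 := hgate t ht x (by linarith)
  rw [radialVelocity_eq_div']
  have h2 : -(ν * max C 1 / cylRadius x) ≤ -(C * ν) / cylRadius x := by
    rw [neg_div]
    refine neg_le_neg (div_le_div_of_nonneg_right ?_ hx.le)
    nlinarith [le_max_left C 1]
  exact h2.trans (div_le_div_of_nonneg_right h1 hx.le)

/-! ## §3 Blow-up reading: recurrent Type-I-rate axial stretching in the parabolic core -/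

/-- **Blow-up under the gate forces RECURRENT Type-I-rate axial stretching inside the parabolic core.** In the
standing class of the stub, under its gate `r u_r ≥ −Cν` on `{cylRadius < δ} × [0,T)` (any `C`), let `ξ₀, κ₀ > 0`
be the constants of `oneSidedRadialCriterion_of_coreAxialStrain_nearTop C` (they depend only on `C`).  If the
solution does NOT extend smoothly past `T`, then for EVERY `T₁ < T` there are `t ∈ [0,T)`, `t ≥ T₁`, and a core
point `x` (`0 < r < δ`, `r < ξ₀√(ν(T−t))`) with `∂_z u_z(t,x) > κ₀/(T−t)`:
`limsup_{t↑T} (T−t)·sup_core ∂_z u_z ≥ κ₀(C)`. [new] -/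
theorem recurrent_coreAxialStretching_of_not_hasSmoothExtensionPast (C : ℝ) :
    ∃ ξ₀ κ₀ : ℝ, 0 < ξ₀ ∧ 0 < κ₀ ∧ ∀ (ν T : ℝ), 0 < ν → 0 < T →
      ∀ (u : ℝ → EuclideanSpace ℝ (Fin 3) → EuclideanSpace ℝ (Fin 3)) (p : ℝ → EuclideanSpace ℝ (Fin 3) → ℝ),
      IsClassicalNSSolutionOn (Ico 0 T) ν 0 u p → IsLerayHopfOn T ν 0 (u 0) u →
      (∀ T' < T, ∃ M : ℝ, ∀ t ∈ Icc 0 T', ∀ x, ‖u t x‖ ≤ M) → (∀ t ∈ Ico 0 T, IsAxisymmetric (u t)) →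
      HasRapidSpatialDecay (u 0) →
      ∀ (δ : ℝ), 0 < δ →
      (∀ t ∈ Ico 0 T, ∀ x : EuclideanSpace ℝ (Fin 3), cylRadius x < δ → -(C * ν) ≤ x 0 * u t x 0 + x 1 * u t x 1) →
      ¬ HasSmoothExtensionPast ν 0 u T →
      ∀ (T₁ : ℝ), T₁ < T → ∃ t ∈ Ico 0 T, T₁ ≤ t ∧ ∃ x : EuclideanSpace ℝ (Fin 3),
        0 < cylRadius x ∧ cylRadius x < δ ∧ cylRadius x < ξ₀ * √(ν * (T - t)) ∧
        κ₀ / (T - t) < fderiv ℝ (u t) x (EuclideanSpace.single 2 1) 2 := by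
  obtain ⟨ξ₀, κ₀, hξ₀, hκ₀, H⟩ := oneSidedRadialCriterion_of_coreAxialStrain_nearTop C
  refine ⟨ξ₀, κ₀, hξ₀, hκ₀, ?_⟩
  intro ν T hν hT u p hcl hLH hbd hax hdec δ hδ hgate hno T₁ hT₁
  by_contra hcon
  refine hno (H ν T hν hT u p hcl hLH hbd hax hdec δ hδ hgate T₁ hT₁ fun t ht htT₁ x hx hxδ hcore => ?_)
  by_contra hlt
  exact hcon ⟨t, ht, htT₁, x, hx, hxδ, hcore, lt_of_not_ge hlt⟩

end Summit.NavierStokesRegularity.NavierStokesRegularity.Theorems.RadialInflowAxialStrain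

end
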